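/-
Copyright (c) 2026 the pub-hodgecm-mathlib formalisation cell (harness21).  Prover seat hodgecm-mathlib-K2E3-p14 (g3), HCML Track B «K2-LIT» (build stream 29),
h413 = `stmt-HodgeConjecture-24833`, line `K2_E3_EllipticInputs`, unit U12 «Characters», socket #11 road (11-SC), letter (SC-an): HARISH-CHANDRA'S THEOREM 20
«cusp-form cancellation», brick (T20-e1′) «FROM `K₀(y⁻¹)` BACK TO `K₀(y)` AND UP TO THE FULL LEVEL `K₁`» — the sequel of ★ (T20-e1) `K2E3CuspFormCancellationCore`
(line lead K2E3-p20 (g3) `CENSUS-Thm20` §2∕§4; K2E3-p14 (g3) `K2/STATUS.md` 2026-09-04T02:01Z).  2026-09-04.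
-/
import Mathlib.Topology.Algebra.OpenSubgroup                                               -- `Subgroup.isClosed_of_isOpen`
import Summits.HodgeConjecture.HodgeConjecture.Theorems.K2E3CuspFormCancellationCore     -- ★ (T20-e1) `setIntegral_eq_zero_of_forall_setIntegral_comp_eq_zero`, `cuspForm_cancellation_conjLevel`
import HarnessLib

/-!
# h413 ∕ Track B «K2-LIT», line `K2_E3_EllipticInputs`, unit U12, road (11-SC), letter (SC-an) — Theorem-20 brick (T20-e1′): HARISH-CHANDRA'S CUSP-FORM CANCELLATION
# IN PRINT'S LITERAL SHAPE `∫_{K₀(y)} f(x k y) dk = 0` AND ON THE FULL LEVEL `∫_{K₁} f(x k y) dk = 0` (Harish-Chandra 1970, Part VII §2 p. 70, §3 p. 71, §8 p. 81)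

Cell `pub/hodgecm-mathlib`, crux H413 = `stmt-HodgeConjecture-24833`, route of record `HCCMUnconditional`; chair K2-lead (g0), dealer K2E3-plan (g2), line lead of the
(SC-an) ∕ Theorem-20 bricks K2E3-p20 (g3).  THEOREMS ONLY (no `def`, no `instance`, no `notation`, no named-fact hypothesis, no `sorry`); lane
`--supports stmt-HodgeConjecture-24833 --as helper`, count-neutral.  Imports: ★ (T20-e1) (which brings ★ (T20-e2), ★ `HaarConjCompact`, Mathlib) + HarnessLib.

THE PRINT.  [HarishChandra1970, Part VII §8 p. 81]: «Fix `f ∈ Φ_C` and put `J(x) = ∫_{K₀(y)} f(xky) dk`.  It is clear that `J(x) = ∫_{K₀(y⁻¹)} f(xyk) dk` where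
`K₀(y⁻¹) = K₀ ∩ K₀^{y⁻¹}`» — the substitution `k = y k′ y⁻¹`, which uses that the Haar measure of `G` is invariant under conjugation by the NON-compact `y`, i.e. that `G`
is unimodular (here: `μ` left AND right invariant, the ★ consumer currency `[μ.IsMulRightInvariant]` of the organ's local groups).  ★ (T20-e1) proves Theorem 20 in the
`K₀(y⁻¹)`-form `∫_{K₀(y⁻¹)} f(xyk) dk = 0`; §1–§2 here turn it into print's literal `∫_{K₀(y)} f(xky) dk = 0`.  [HarishChandra1970, Part VII §3 p. 71]: «it follows from
Theorem 20 that `∫_{K₁} f_γ(x k y₀) dk = 0` unless `1 + σ(xk) ≤ c(1+σ(C_γ))(1+σ(y₀))`, where `k` runs over a set of representatives of `K₁/K₀(y₀)` in `K₁`.  Now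
`σ(xk) = σ(x)`» — the upgrade from the sub-level `K₀(y)` to the full level `K₁ ⊆ Ω_0`; §3 here does it by the Fubini averaging of ★ (T20-e1) §2 (no coset representatives):
`μ(K₀(y)) · ∫_{K₁} f(xky) dk = ∫_{K₁} dk ∫_{K₀(y)} f(x k k′ y) dk′ = 0` because `x k ∉ Ω_R` whenever `x ∉ Ω_R` and `k ∈ K₁ ⊆ Ω_0`.

* §1 `setIntegral_conj_comm` — `∫_{k ∈ A} F(x k y) dμ = ∫_{k : y k y⁻¹ ∈ A} F(x y k) dμ` for `μ` left and right invariant (conjugation by `y` preserves `μ`).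
* §2 `cuspForm_cancellation_conjLevel'` — THEOREM 20 in print's literal shape: `∫_{K₀(y)} f(x k y) dμ(k) = 0` for `y ∈ Ω s`, `x ∉ Ω (m_C + (m + 2s + 4 m_C) + s)`
  (★ (T20-e1) `cuspForm_cancellation_conjLevel` ∘ §1), `K₀(y) := K₀ ⊓ y K₀ y⁻¹`.
* §3 `setIntegral_eq_zero_of_forall_setIntegral_sublevel_eq_zero` — the averaging upgrade `K″ ≤ K₁` (★ (T20-e1) §2 with `Y = G`), and **`cuspForm_cancellation_levelOne`**:
  `∫_{K₁} f(x k y) dμ(k) = 0` for `y ∈ Ω s`, `x ∉ Ω (m_C + (m + 2s + 4 m_C) + s)`, `K₀ ≤ K₁ ⊆ Ω 0`, `K₁` compact open — the form the (SC-lim∖ell) assembly consumes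
  («`Θ_T(γ^y)` is constant in `T` as soon as `T ≥ c₁(1+|λ(γ)|)²`», p. 71).

HONEST LABEL.  HC_CM is proved only modulo the 7 printed citations (2 remaining named inputs: hLiu418 = `stmt-HodgeConjecture-24832`, h413 = `stmt-HodgeConjecture-24833`)
until rung 0 closes; this file is a count-neutral helper (measure-theoretic bookkeeping of print's proof; nothing printed is asserted as a fact).

## References
* [HarishChandra1970] Harish-Chandra (notes by G. van Dijk), *Harmonic Analysis on Reductive p-adic Groups*, LNM 162 (1970), Part VII §2 p. 70 (Theorem 20), §3 p. 71
  (the `K₁/K₀(y₀)` step), §8 p. 81 (`J(x) = ∫_{K₀(y⁻¹)} f(xyk) dk`).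
* [Folland1995] G. B. Folland, *A Course in Abstract Harmonic Analysis* (1995), §2.4 (unimodular groups; conjugation and the modular function).
-/

set_option autoImplicit false
set_option linter.dupNamespace false  -- the mandated namespace repeats the single-problem summit's segment (`HodgeConjecture.HodgeConjecture`)

noncomputable section

open MeasureTheory MeasureTheory.Measure Topology Set
open scoped Pointwise ENNReal

namespace Summit.HodgeConjecture.HodgeConjecture.Cruxes.H413.K2E3CuspFormCancellationLevelOne

open Summit.HodgeConjecture.HodgeConjecture.Cruxes.H413.K2E3CuspFormCancellationCore

variable {G : Type*} [Group G] [TopologicalSpace G] [IsTopologicalGroup G] [MeasurableSpace G] [BorelSpace G]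
variable {E : Type*} [NormedAddCommGroup E] [NormedSpace ℝ E]

/-! ## §1 Conjugation by `y` in a set integral (unimodular `μ`) -/

section Conj

variable (μ : Measure G) [μ.IsMulLeftInvariant] [μ.IsMulRightInvariant]

/-- **«`J(x) = ∫_{K₀(y)} f(xky) dk = ∫_{K₀(y⁻¹)} f(xyk) dk`»** in general form: for `μ` left and right invariant (so invariant under `k ↦ y k y⁻¹`) and any `A ⊆ G`,
`∫_{k ∈ A} F(x k y) dμ(k) = ∫_{k : y k y⁻¹ ∈ A} F(x y k) dμ(k)` (substitute `k = y k′ y⁻¹`; no measurability of `F` or `A` needed, conjugation being a measurable equivalence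
preserving `μ`). [cite: HarishChandra1970, Part VII §8 p. 81] [cite: Folland1995, §2.4] -/
theorem setIntegral_conj_comm (F : G → E) (A : Set G) (x y : G) :
    ∫ k in A, F (x * k * y) ∂μ = ∫ k in {k : G | y * k * y⁻¹ ∈ A}, F (x * y * k) ∂μ := by
  set e : G ≃ᵐ G := (MeasurableEquiv.mulLeft y).trans (MeasurableEquiv.mulRight y⁻¹) with he_def
  have he : (e : G → G) = fun k => y * k * y⁻¹ := by
    funext k
    simp [he_def, MeasurableEquiv.coe_mulLeft, MeasurableEquiv.coe_mulRight]
  have hmap : μ.map e = μ := by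
    rw [he, show (fun k : G => y * k * y⁻¹) = (· * y⁻¹) ∘ (y * ·) from rfl,
      ← Measure.map_map (measurable_mul_const y⁻¹) (measurable_const_mul y), map_mul_left_eq_self, map_mul_right_eq_self]
  have h := setIntegral_map_equiv (μ := μ) e (fun k => F (x * k * y)) A
  rw [hmap] at h
  rw [h, he]
  refine integral_congr_ae (Filter.Eventually.of_forall fun k => ?_)
  show F (x * (y * k * y⁻¹) * y) = F (x * y * k)
  congr 1
  group

end Conj

/-! ## §2 Theorem 20 in print's literal shape `∫_{K₀(y)} f(x k y) dk = 0` -/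

section PrintShape

variable [SecondCountableTopology G] [LocallyCompactSpace G] (μ : Measure G) [μ.IsHaarMeasure] [μ.IsMulRightInvariant]
  (Ω : ℕ → Set G) (K₀ T N Nbar A : Subgroup G) (Aplus Aminus : Set G) (L : ℕ → Subgroup G)
  (ν : Measure ↥N) [SFinite ν] [ν.IsOpenPosMeasure] [IsFiniteMeasureOnCompacts ν] [ν.IsMulLeftInvariant]
  (νbar : Measure ↥Nbar) [SFinite νbar] [νbar.IsOpenPosMeasure] [IsFiniteMeasureOnCompacts νbar] [νbar.IsMulLeftInvariant]

omit [TopologicalSpace G] [IsTopologicalGroup G] [MeasurableSpace G] [BorelSpace G] [SecondCountableTopology G] [LocallyCompactSpace G] in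
/-- Membership in `K₀(y) := K₀ ⊓ y K₀ y⁻¹` (the image of `K₀` under `MulAut.conj y`): `k ∈ K₀ ∧ y⁻¹ k y ∈ K₀`. [cite: HarishChandra1970, Part VII §2 p. 70] -/
theorem mem_inf_map_conj_iff (y k : G) :
    k ∈ K₀ ⊓ K₀.map (MulAut.conj y).toMonoidHom ↔ k ∈ K₀ ∧ y⁻¹ * k * y ∈ K₀ := by
  rw [Subgroup.mem_inf, Subgroup.mem_map_equiv, MulAut.conj_symm_apply]

omit [MeasurableSpace G] [BorelSpace G] [SecondCountableTopology G] [LocallyCompactSpace G] in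
/-- `K₀(y) = K₀ ∩ y K₀ y⁻¹` is open when `K₀` is. [cite: HarishChandra1970, Part VII §2 p. 70] -/
theorem isOpen_inf_map_conj (hK₀o : IsOpen (K₀ : Set G)) (y : G) :
    IsOpen ((K₀ ⊓ K₀.map (MulAut.conj y).toMonoidHom : Subgroup G) : Set G) := by
  have hset : ((K₀ ⊓ K₀.map (MulAut.conj y).toMonoidHom : Subgroup G) : Set G) = (K₀ : Set G) ∩ (fun k : G => y⁻¹ * k * y) ⁻¹' (K₀ : Set G) := by
    ext k
    rw [SetLike.mem_coe, mem_inf_map_conj_iff]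
    rfl
  rw [hset]
  exact hK₀o.inter (hK₀o.preimage ((continuous_const.mul continuous_id).mul continuous_const))

/-- **THEOREM 20 IN PRINT'S LITERAL SHAPE** `∫_{K₀(y)} f(x k y) dk = 0`, `K₀(y) = K₀ ∩ K₀^y = K₀ ⊓ y K₀ y⁻¹`: under the data of ★ (T20-e1) `cuspForm_cancellation_conjLevel`
(height balls `Ω`, level `K₀ ⊆ Ω 0` open and compact with both Iwahori orders, deep level «`∀ u ∈ L (m+2s), u ∈ K₀ ∧ y u y⁻¹ ∈ K₀`» for `y ∈ Ω s`, `A = A⁺ ∪ A⁻` with the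
contractions, `N`, `N̄` closed with left-invariant `ν`, `ν̄`, `f` continuous with `supp ⊆ C·A`, `C ⊆ Ω m_C`, a cusp form along `N` and `N̄`) and for `μ` a left AND right
invariant Haar measure on `G` (unimodular `G`): for `x ∉ Ω (m_C + (m + 2s + 4 m_C) + s)`, **`∫_{k ∈ K₀(y)} f(x k y) dμ(k) = 0`** (★ `cuspForm_cancellation_conjLevel` at the
level `K₀(y⁻¹) = K₀ ⊓ y⁻¹K₀y` ∘ §1). [cite: HarishChandra1970, Part VII §2 Theorem 20 p. 70; §8 p. 81] -/
theorem cuspForm_cancellation_conjLevel'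
    (hΩmul : ∀ {a b : ℕ} {g g' : G}, g ∈ Ω a → g' ∈ Ω b → g * g' ∈ Ω (a + b)) (hΩinv : ∀ {a : ℕ} {g : G}, g ∈ Ω a → g⁻¹ ∈ Ω a)
    (hK₀ : (K₀ : Set G) ⊆ Ω 0) {m s : ℕ} {y : G} (hy : y ∈ Ω s) (hdeep : ∀ u ∈ L (m + 2 * s), u ∈ K₀ ∧ y * u * y⁻¹ ∈ K₀)
    (hK₀o : IsOpen (K₀ : Set G)) (hK₀c : IsCompact (K₀ : Set G)) (hN : IsClosed (N : Set G)) (hNbar : IsClosed (Nbar : Set G))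
    (f : G → E) (hf : Continuous f) (C : Set G) {mC : ℕ} (hC : C ⊆ Ω mC) (hsupp : ∀ g, f g ≠ 0 → g ∈ C * (A : Set G))
    (hcusp : ∀ x : G, ∫ n : ↥N, f (x * ↑n) ∂ν = 0) (hcuspbar : ∀ x : G, ∫ v : ↥Nbar, f (x * ↑v) ∂νbar = 0)
    (hAcover : ∀ a ∈ A, a ∈ Aplus ∨ a ∈ Aminus)
    (hIw : ∀ k ∈ K₀, ∃ v ∈ K₀ ⊓ Nbar, ∃ t ∈ K₀ ⊓ T, ∃ u ∈ K₀ ⊓ N, k = v * t * u)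
    (hIw' : ∀ k ∈ K₀, ∃ u ∈ K₀ ⊓ N, ∃ t ∈ K₀ ⊓ T, ∃ v ∈ K₀ ⊓ Nbar, k = u * t * v)
    (hT : ∀ a ∈ A, ∀ t ∈ K₀ ⊓ T, a * t * a⁻¹ ∈ K₀)
    (hnormN : ∀ a ∈ A, ∀ n ∈ N, a * n * a⁻¹ ∈ N) (hnormNbar : ∀ a ∈ A, ∀ v ∈ Nbar, a * v * a⁻¹ ∈ Nbar)
    (h54N : ∀ n ∈ N, ∀ a' ∈ A, ∀ c : ℕ, n * a' ∈ Ω c → n ∈ Ω (2 * c))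
    (h54Nbar : ∀ v ∈ Nbar, ∀ a' ∈ A, ∀ c : ℕ, v * a' ∈ Ω c → v ∈ Ω (2 * c))
    (hplusV : ∀ a ∈ Aplus, ∀ v ∈ K₀ ⊓ Nbar, a * v * a⁻¹ ∈ K₀)
    (hplusC : ∀ a ∈ Aplus, ∀ (h c j : ℕ), a ∉ Ω h → j + c ≤ h + 1 → ∀ n ∈ N, n ∈ Ω c → a⁻¹ * n * a ∈ L j)
    (hminusV : ∀ a ∈ Aminus, ∀ u ∈ K₀ ⊓ N, a * u * a⁻¹ ∈ K₀)
    (hminusC : ∀ a ∈ Aminus, ∀ (h c j : ℕ), a ∉ Ω h → j + c ≤ h + 1 → ∀ v ∈ Nbar, v ∈ Ω c → a⁻¹ * v * a ∈ L j)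
    {x : G} (hx : x ∉ Ω (mC + (m + 2 * s + 4 * mC) + s)) :
    ∫ k in ((K₀ ⊓ K₀.map (MulAut.conj y).toMonoidHom : Subgroup G) : Set G), f (x * k * y) ∂μ = 0 := by
  -- the level on the `y⁻¹` side, `K′ := K₀(y⁻¹) = K₀ ⊓ y⁻¹ K₀ y`
  set K' : Subgroup G := K₀ ⊓ K₀.map (MulAut.conj y⁻¹).toMonoidHom with hK'_def
  have hK'mem : ∀ k, k ∈ K' ↔ k ∈ K₀ ∧ y * k * y⁻¹ ∈ K₀ := by
    intro k
    rw [hK'_def, mem_inf_map_conj_iff, inv_inv]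
  have hK'o : IsOpen (K' : Set G) := isOpen_inf_map_conj K₀ hK₀o y⁻¹
  have hK'c : IsCompact (K' : Set G) :=
    hK₀c.of_isClosed_subset (K'.isClosed_of_isOpen hK'o) fun k hk => ((hK'mem k).1 hk).1
  -- print's first line: `∫_{K₀(y)} f(xky) dk = ∫_{K₀(y⁻¹)} f(xyk) dk`
  have hset : {k : G | y * k * y⁻¹ ∈ ((K₀ ⊓ K₀.map (MulAut.conj y).toMonoidHom : Subgroup G) : Set G)} = (K' : Set G) := by
    ext k
    simp only [mem_setOf_eq, SetLike.mem_coe, mem_inf_map_conj_iff, hK'mem]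
    constructor
    · rintro ⟨h1, h2⟩
      refine ⟨?_, h1⟩
      have e : y⁻¹ * (y * k * y⁻¹) * y = k := by group
      rwa [e] at h2
    · rintro ⟨h1, h2⟩
      refine ⟨h2, ?_⟩
      have e : y⁻¹ * (y * k * y⁻¹) * y = k := by group
      rwa [e]
  rw [setIntegral_conj_comm μ f _ x y, hset]
  exact cuspForm_cancellation_conjLevel μ Ω K₀ K' T N Nbar A Aplus Aminus L ν νbar hΩmul hΩinv hK₀ hy hK'mem hdeep hK'o hK'c hN hNbar f hf C hC hsupp
    hcusp hcuspbar hAcover hIw hIw' hT hnormN hnormNbar h54N h54Nbar hplusV hplusC hminusV hminusC hx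

end PrintShape

/-! ## §3 From the sub-level `K₀(y)` to the full level `K₁` («`k` runs over representatives of `K₁/K₀(y₀)`», p. 71) -/

section LevelOne

variable [SecondCountableTopology G] [LocallyCompactSpace G] (μ : Measure G) [μ.IsHaarMeasure]

/-- **THE AVERAGING UPGRADE `K″ ≤ K₁`**: `K₁ ≤ G` compact open, `K″ ≤ K₁` an open subgroup, `μ` a left Haar measure, `F : G → E` continuous.  If `∫_{k′ ∈ K″} F(k k′) dμ = 0`
for every `k ∈ K₁` then `∫_{k ∈ K₁} F(k) dμ = 0` — ★ (T20-e1) `setIntegral_eq_zero_of_forall_setIntegral_comp_eq_zero` with `Y = G`, `S = K″` (`0 < μ(K″) < ∞`), replacing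
print's sum over coset representatives of `K₁/K″`. [cite: HarishChandra1970, Part VII §3 p. 71] [cite: Folland1995, §2.4] -/
theorem setIntegral_eq_zero_of_forall_setIntegral_sublevel_eq_zero (K₁ K'' : Subgroup G) (hle : K'' ≤ K₁)
    (hK''o : IsOpen (K'' : Set G)) (hK₁o : IsOpen (K₁ : Set G)) (hK₁c : IsCompact (K₁ : Set G))
    (F : G → E) (hF : Continuous F) (h : ∀ k ∈ K₁, ∫ k' in (K'' : Set G), F (k * k') ∂μ = 0) :
    ∫ k in (K₁ : Set G), F k ∂μ = 0 := by
  have hK''c : IsCompact (K'' : Set G) := hK₁c.of_isClosed_subset (K''.isClosed_of_isOpen hK''o) hle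
  exact setIntegral_eq_zero_of_forall_setIntegral_comp_eq_zero μ K₁ μ (fun k : G => k) continuous_id (K'' : Set G) hK''o.measurableSet hK''c
    (hK''o.measure_ne_zero μ ⟨1, K''.one_mem⟩) hK''c.measure_lt_top (fun _ hk => hle hk) hK₁o.measurableSet hK₁c hK₁c.measure_lt_top
    (fun _ hk => Literature.NumberTheory.Automorphic.map_mul_right_eq_self_of_mem_isCompact μ hK₁c hk) F hF h

variable [μ.IsMulRightInvariant]
  (Ω : ℕ → Set G) (K₁ K₀ T N Nbar A : Subgroup G) (Aplus Aminus : Set G) (L : ℕ → Subgroup G)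
  (ν : Measure ↥N) [SFinite ν] [ν.IsOpenPosMeasure] [IsFiniteMeasureOnCompacts ν] [ν.IsMulLeftInvariant]
  (νbar : Measure ↥Nbar) [SFinite νbar] [νbar.IsOpenPosMeasure] [IsFiniteMeasureOnCompacts νbar] [νbar.IsMulLeftInvariant]

/-- **THEOREM 20 ON THE FULL LEVEL `K₁`** (the form (SC-lim∖ell) consumes, p. 71: «`∫_{K₁} f_γ(x k y₀) dk = 0` unless `1 + σ(xk) ≤ c(1+σ(C_γ))(1+σ(y₀))` … Now `σ(xk) = σ(x)`»):
under the data of `cuspForm_cancellation_conjLevel'` plus a compact open level `K₁` with `K₀ ≤ K₁ ⊆ Ω 0`, for `y ∈ Ω s` and `x ∉ Ω (m_C + (m + 2s + 4 m_C) + s)`: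
**`∫_{k ∈ K₁} f(x k y) dμ(k) = 0`**.  Proof: for `k ∈ K₁ ⊆ Ω 0`, `x k ∉ Ω (…)` (else `x = (xk)k⁻¹ ∈ Ω (…)`), so `∫_{K₀(y)} f(x k k′ y) dk′ = 0` by §2, and §3's averaging over
`K₀(y) ≤ K₁` concludes. [cite: HarishChandra1970, Part VII §2 Theorem 20 p. 70; §3 p. 71] -/
theorem cuspForm_cancellation_levelOne
    (hΩmul : ∀ {a b : ℕ} {g g' : G}, g ∈ Ω a → g' ∈ Ω b → g * g' ∈ Ω (a + b)) (hΩinv : ∀ {a : ℕ} {g : G}, g ∈ Ω a → g⁻¹ ∈ Ω a)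
    (hK₁ : (K₁ : Set G) ⊆ Ω 0) (hK₀K₁ : K₀ ≤ K₁) {m s : ℕ} {y : G} (hy : y ∈ Ω s) (hdeep : ∀ u ∈ L (m + 2 * s), u ∈ K₀ ∧ y * u * y⁻¹ ∈ K₀)
    (hK₁o : IsOpen (K₁ : Set G)) (hK₁c : IsCompact (K₁ : Set G)) (hK₀o : IsOpen (K₀ : Set G))
    (hN : IsClosed (N : Set G)) (hNbar : IsClosed (Nbar : Set G))
    (f : G → E) (hf : Continuous f) (C : Set G) {mC : ℕ} (hC : C ⊆ Ω mC) (hsupp : ∀ g, f g ≠ 0 → g ∈ C * (A : Set G))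
    (hcusp : ∀ x : G, ∫ n : ↥N, f (x * ↑n) ∂ν = 0) (hcuspbar : ∀ x : G, ∫ v : ↥Nbar, f (x * ↑v) ∂νbar = 0)
    (hAcover : ∀ a ∈ A, a ∈ Aplus ∨ a ∈ Aminus)
    (hIw : ∀ k ∈ K₀, ∃ v ∈ K₀ ⊓ Nbar, ∃ t ∈ K₀ ⊓ T, ∃ u ∈ K₀ ⊓ N, k = v * t * u)
    (hIw' : ∀ k ∈ K₀, ∃ u ∈ K₀ ⊓ N, ∃ t ∈ K₀ ⊓ T, ∃ v ∈ K₀ ⊓ Nbar, k = u * t * v)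
    (hT : ∀ a ∈ A, ∀ t ∈ K₀ ⊓ T, a * t * a⁻¹ ∈ K₀)
    (hnormN : ∀ a ∈ A, ∀ n ∈ N, a * n * a⁻¹ ∈ N) (hnormNbar : ∀ a ∈ A, ∀ v ∈ Nbar, a * v * a⁻¹ ∈ Nbar)
    (h54N : ∀ n ∈ N, ∀ a' ∈ A, ∀ c : ℕ, n * a' ∈ Ω c → n ∈ Ω (2 * c))
    (h54Nbar : ∀ v ∈ Nbar, ∀ a' ∈ A, ∀ c : ℕ, v * a' ∈ Ω c → v ∈ Ω (2 * c))
    (hplusV : ∀ a ∈ Aplus, ∀ v ∈ K₀ ⊓ Nbar, a * v * a⁻¹ ∈ K₀)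
    (hplusC : ∀ a ∈ Aplus, ∀ (h c j : ℕ), a ∉ Ω h → j + c ≤ h + 1 → ∀ n ∈ N, n ∈ Ω c → a⁻¹ * n * a ∈ L j)
    (hminusV : ∀ a ∈ Aminus, ∀ u ∈ K₀ ⊓ N, a * u * a⁻¹ ∈ K₀)
    (hminusC : ∀ a ∈ Aminus, ∀ (h c j : ℕ), a ∉ Ω h → j + c ≤ h + 1 → ∀ v ∈ Nbar, v ∈ Ω c → a⁻¹ * v * a ∈ L j)
    {x : G} (hx : x ∉ Ω (mC + (m + 2 * s + 4 * mC) + s)) :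
    ∫ k in (K₁ : Set G), f (x * k * y) ∂μ = 0 := by
  have hK₀ : (K₀ : Set G) ⊆ Ω 0 := fun k hk => hK₁ (hK₀K₁ hk)
  have hK₀c : IsCompact (K₀ : Set G) := hK₁c.of_isClosed_subset (K₀.isClosed_of_isOpen hK₀o) hK₀K₁
  refine setIntegral_eq_zero_of_forall_setIntegral_sublevel_eq_zero μ K₁ (K₀ ⊓ K₀.map (MulAut.conj y).toMonoidHom)
    (fun k hk => hK₀K₁ (Subgroup.mem_inf.1 hk).1) (isOpen_inf_map_conj K₀ hK₀o y) hK₁o hK₁c (fun k => f (x * k * y))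
    (hf.comp ((continuous_const.mul continuous_id).mul continuous_const)) fun k hk => ?_
  -- for `k ∈ K₁ ⊆ Ω 0`, `x k ∉ Ω (…)`
  have hxk : x * k ∉ Ω (mC + (m + 2 * s + 4 * mC) + s) := by
    intro hxk
    apply hx
    have h1 := hΩmul hxk (hΩinv (hK₁ hk))
    rwa [add_zero, mul_inv_cancel_right] at h1
  have h20 := cuspForm_cancellation_conjLevel' μ Ω K₀ T N Nbar A Aplus Aminus L ν νbar hΩmul hΩinv hK₀ hy hdeep hK₀o hK₀c hN hNbar f hf C hC hsupp
    hcusp hcuspbar hAcover hIw hIw' hT hnormN hnormNbar h54N h54Nbar hplusV hplusC hminusV hminusC hxk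
  simpa only [mul_assoc] using h20

end LevelOne

end Summit.HodgeConjecture.HodgeConjecture.Cruxes.H413.K2E3CuspFormCancellationLevelOne

end
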